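import Literature.IUT.HodgeTheaters.TemperedCoveringsProp24iiObservationArith
import HarnessLib

/-!
# [IUTchI] Prop. 2.4 (ii) at the genuine 𝔛-datum: "this observation" keyed on [SemiAnbd] Thm. 5.4 (i) for the
# CANONICAL augmentation `Π^tp_X/Ker(J ↠ Π^tp_{𝔾*_J}) → G_k`, with arithmetic ampleness PROVED

Mochizuki, *Inter-universal Teichmüller theory I*, kurims manuscript (May 2020), §2, proof of Prop. 2.4 (ii),
p. 50 l. 52 – p. 51 l. 13 ("if `Λ ⊆ Π^tp_X` … whose image in `G_k` is open … [SemiAnbd], Theorem 5.4, (ii);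
[SemiAnbd], Example 5.6") [cite: Mochizuki2012, Prop 2.4(ii) pp.50-51] (D-0012 claim key; nothing of the series is
asserted here), over Mochizuki, *Semi-graphs of anabelioids*, Publ. RIMS **42** (2006), Def. 5.3 (i) p. 65
("arithmetically ample … surjects onto an open subgroup of `Π_A`") and Thm. 5.4 (i) p. 66
[cite: MochizukiSemiAnbd2006, Def 5.3(i) p.65].  Pages: [IUTchI] = kurims preprint render
IUTchI-kurims-url-690e7b3c6199; [SemiAnbd] = kurims render SemiAnbd-kurims-url-f33ace170ff4 (lit/SOURCES.md §0/§11).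

PROOF-ONLY sequel (abc-iut-L5-t11; no definitions, no new `Prop` fact) of
`TemperedCoveringsProp24iiObservationArith.lean`.  There the per-level pull-back law `hK` asked, for the `ι`-preimage
`K` of a `Π̂_j`-conjugate of the image of `Λ`, BOTH compactness and arithmetic ampleness w.r.t. an ABSTRACT augmentation
`augTp j`.  At the genuine 𝔛-datum the augmentation of the level quotient is CANONICAL — the map
`Π^temp_{X_K} ⧸ admKer_j → G_K` induced by `Π^temp_{X_K} → G_K` (`admKer_j ⊆ Δ^temp_X`), resp.
`Π_{X_K} ⧸ closure ι(admKer_j) → G_K` — and the AMPLENESS half of `hK` is a THEOREM: the image of `K` in `G_K` is the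
conjugate, by the image of `γ`, of the (open) image of `Λ`.  Result `OfSpecialFibre.prop24ii_ofPiData_of_arithStatementI_canonical`:
[IUTchI] Prop. 2.4 (ii) AS TYPED at `ofSpecialFibre X d S …` over `P : SpecialFibreTower.PiData` from `hadm` and, per level `j`,
(a) abc-iut-L3's `ArithMaximalCompactStatementI (Dd j) a` for the canonical tempered augmentation `a` (characterised by
`a ∘ qtp_j = (Π^temp_{X_K} → G_K)`), (b) (A0)_j: the `ι`-preimage in `Π^tp_j` of a `Π̂_j`-conjugate of the image of a
compact open-image `Λ` lying in `ι(Π^tp_j)` is compact, (c) (A3-arith)_j, plus the per-level `DecompositionData` and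
node/branch data.  DISCHARGE ROUTE for (a): abc-iut-L3's `arithMaximalCompactStatementI_and_II_ofChartAt` at finite
level graphs, once the level quotient is identified with L3's produced chart data (L3-side).
CONDITIONAL, as labelled; typed ≠ discharged; `P` is origin data inhabited at model towers only; nothing here asserts
that abc is proved or refuted, and nothing here bears on [IUTchIII] Cor. 3.12.
-/

noncomputable section

namespace Literature.IUT.HodgeTheaters

open _root_.Topology
open scoped Pointwise
open Literature.AnabelianGeometry.SemiGraphs Literature.AnabelianGeometry.SemiGraphs.ProfiniteSemiGraph

namespace StableCurveTemperedData

namespace OfSpecialFibre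

/-- Conjugates of open subgroups are open. [folklore] -/
private theorem isOpen_conj_smul {G : Type*} [Group G] [TopologicalSpace G] [IsTopologicalGroup G] (x : G)
    {H : Subgroup G} (hH : IsOpen (H : Set G)) : IsOpen ((MulAut.conj x • H : Subgroup G) : Set G) := by
  have e : ((MulAut.conj x • H : Subgroup G) : Set G) = (fun y => x⁻¹ * y * x⁻¹⁻¹) ⁻¹' (H : Set G) := by
    ext y
    rw [SetLike.mem_coe, Subgroup.mem_pointwise_smul_iff_inv_smul_mem, Set.mem_preimage, SetLike.mem_coe,
      ← map_inv, MulAut.smul_def, MulAut.conj_apply]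
  rw [e]
  exact hH.preimage ((continuous_const.mul continuous_id).mul continuous_const)

/-- The image under a homomorphism of a conjugate `γ • M` is the conjugate by the image of `γ` of the image. [folklore] -/
private theorem map_conj_smul {G H : Type*} [Group G] [Group H] (f : G →* H) (γ : G) (M : Subgroup G) :
    (MulAut.conj γ • M).map f = MulAut.conj (f γ) • M.map f := by
  ext z
  constructor
  · rintro ⟨y, hy, rfl⟩
    rw [SetLike.mem_coe, Subgroup.mem_smul_pointwise_iff_exists] at hy
    obtain ⟨m, hm, rfl⟩ := hy
    rw [Subgroup.mem_smul_pointwise_iff_exists]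
    exact ⟨f m, ⟨m, hm, rfl⟩, by simp only [MulAut.smul_def, MulAut.conj_apply, map_mul, map_inv]⟩
  · intro hz
    rw [Subgroup.mem_smul_pointwise_iff_exists] at hz
    obtain ⟨_, ⟨m, hm, rfl⟩, rfl⟩ := hz
    refine ⟨MulAut.conj γ • m, ?_, by simp only [MulAut.smul_def, MulAut.conj_apply, map_mul, map_inv]⟩
    rw [SetLike.mem_coe, Subgroup.mem_smul_pointwise_iff_exists]
    exact ⟨m, hm, rfl⟩

variable {p : ℕ} [Fact p.Prime] (X : TemperedCurve p) (T : SpecialFibreTower X.DeltaTemp) (d : X.GroupLevelData)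
  (S : SpecialFibreData (X.toTemperedArithmeticGroup d)) (h36 : S.Gc.Prop36Hypotheses)
  (Sigma SigmaHat : Set ℕ) (hsub : Sigma ⊆ SigmaHat) (hne : Set.Nonempty Sigma)
  (hprime : ∀ q ∈ SigmaHat, q.Prime) (hp : p ∉ Sigma) (TpH : Subgroup S.chart.G)
  (HatH : Subgroup (TemperedGraphGroupData.exists_completion_of_prop36 S.Gc h36 S.chart).choose)
  (hle : TpH.map (TemperedGraphGroupData.exists_completion_of_prop36 S.Gc h36
    S.chart).choose_spec.choose.toMonoidHom ≤ HatH)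
  (cuspMeetsH : {x : X.Pt // X.IsCusp x} → Prop)

/-- `admKer_j ⊆ Ker(Π^temp_{X_K} → G_K)` (`admKer_j ⊆ Δ^temp_X = Ker`). ([IUTchI] Prop 2.4(ii) p.51) [claim: Mochizuki2012, status: disputed] -/
theorem admKerPi_le_ker_augGK (j : ℕ) : admKerPi X T j ≤ X.augGK.toMonoidHom.ker := by
  rw [ker_augGK_eq_deltaTemp]
  exact admKerPi_le_deltaTemp X T j

include d in
/-- `closure ι(admKer_j) ⊆ Ker(Π_{X_K} → G_K)` (`= Δ_X`). ([IUTchI] Prop 2.4(ii) p.51) [claim: Mochizuki2012, status: disputed] -/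
theorem admKerHat_le_ker_augHatGK (j : ℕ) : admKerHat X T j ≤ (augHatGK X).ker := by
  rw [ker_augHatGK_eq_deltaHat X d]
  exact admKerHat_le_deltaHat X T j

/-- **[IUTchI] Prop. 2.4 (ii) AS TYPED at the genuine 𝔛-datum over `P`, "this observation" keyed on [SemiAnbd]
Thm. 5.4 (i) for the CANONICAL augmentation of every level quotient, arithmetic ampleness PROVED.**  Laws: `hadm`;
per level `j`: `hI` — abc-iut-L3's `ArithMaximalCompactStatementI (Dd j) a` for every `a : Π^tp_j → G_K` with
`a ∘ qtp_j = (Π^temp_{X_K} → G_K)` (i.e. for the canonical augmentation); `hA0` — (A0) at the level quotient; `hA3` —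
(A3-arith).  Data: per-level `DecompositionData` (vertex/branch decomposition groups in `Π^tp_j`), nodes with
tempered branch conjugators.  The ampleness of the pulled-back conjugates ("image in `G_k` is open", Def. 5.3 (i)) is
proved: that image is the conjugate by the image of `γ` of the image of `Λ`.
([IUTchI] Prop 2.4(ii) pp.50-51) [claim: Mochizuki2012, status: disputed] -/
theorem prop24ii_ofPiData_of_arithStatementI_canonical (P : SpecialFibreTower.PiData X d S T)
    (hadm : ∀ U ∈ 𝓝 (1 : ↥X.DeltaTemp), ∃ j, ((T.admKer j : Subgroup ↥X.DeltaTemp) : Set ↥X.DeltaTemp) ⊆ U)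
    {V B : ℕ → Type*}
    (Dd : ∀ j, DecompositionData ((qTowerOfSpecialFibreTower X T d S h36 Sigma SigmaHat hsub hne hprime hp TpH HatH hle cuspMeetsH P.admKer_normal_pi).Q j).Tp (V j) (B j))
    (hI : ∀ (j : ℕ) (a : ((qTowerOfSpecialFibreTower X T d S h36 Sigma SigmaHat hsub hne hprime hp TpH HatH hle cuspMeetsH P.admKer_normal_pi).Q j).Tp →* X.GK),
      a.comp ((qTowerOfSpecialFibreTower X T d S h36 Sigma SigmaHat hsub hne hprime hp TpH HatH hle cuspMeetsH P.admKer_normal_pi).qtp j) = X.augGK.toMonoidHom →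
        ArithMaximalCompactStatementI (Dd j) a)
    (hA0 : ∀ (j : ℕ) (Λ : Subgroup X.PiTemp), IsCompact (Λ : Set X.PiTemp) → Λ ≠ ⊥ →
      IsOpen (Λ.map X.augGK.toMonoidHom : Set X.GK) →
      ∀ γ : ((qTowerOfSpecialFibreTower X T d S h36 Sigma SigmaHat hsub hne hprime hp TpH HatH hle cuspMeetsH P.admKer_normal_pi).Q j).Hat,
        MulAut.conj γ • Λ.map (((qTowerOfSpecialFibreTower X T d S h36 Sigma SigmaHat hsub hne hprime hp TpH HatH hle cuspMeetsH P.admKer_normal_pi).qhat j).comp X.toHat.toMonoidHom) ≤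
          ((qTowerOfSpecialFibreTower X T d S h36 Sigma SigmaHat hsub hne hprime hp TpH HatH hle cuspMeetsH P.admKer_normal_pi).Q j).ι.range →
          IsCompact ((((MulAut.conj γ • Λ.map (((qTowerOfSpecialFibreTower X T d S h36 Sigma SigmaHat hsub hne hprime hp TpH HatH hle cuspMeetsH P.admKer_normal_pi).qhat j).comp X.toHat.toMonoidHom)).comap
              ((qTowerOfSpecialFibreTower X T d S h36 Sigma SigmaHat hsub hne hprime hp TpH HatH hle cuspMeetsH P.admKer_normal_pi).Q j).ι :
              Subgroup ((qTowerOfSpecialFibreTower X T d S h36 Sigma SigmaHat hsub hne hprime hp TpH HatH hle cuspMeetsH P.admKer_normal_pi).Q j).Tp)) :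
              Set ((qTowerOfSpecialFibreTower X T d S h36 Sigma SigmaHat hsub hne hprime hp TpH HatH hle cuspMeetsH P.admKer_normal_pi).Q j).Tp))
    {E : ℕ → Type*} (src tgt : ∀ j, E j → V j)
    (c₁ c₂ : ∀ j, E j → ((qTowerOfSpecialFibreTower X T d S h36 Sigma SigmaHat hsub hne hprime hp TpH HatH hle cuspMeetsH P.admKer_normal_pi).Q j).Tp)
    (hA3 : ∀ (j : ℕ) (Λ : Subgroup X.PiTemp), IsCompact (Λ : Set X.PiTemp) → Λ ≠ ⊥ →
      IsOpen (Λ.map X.augGK.toMonoidHom : Set X.GK) →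
      ∀ (v w : V j) (g h γ : ((qTowerOfSpecialFibreTower X T d S h36 Sigma SigmaHat hsub hne hprime hp TpH HatH hle cuspMeetsH P.admKer_normal_pi).Q j).Hat),
        MulAut.conj γ • Λ.map (((qTowerOfSpecialFibreTower X T d S h36 Sigma SigmaHat hsub hne hprime hp TpH HatH hle cuspMeetsH P.admKer_normal_pi).qhat j).comp X.toHat.toMonoidHom) ≤
            MulAut.conj g • ((Dd j).vertGp v).map ((qTowerOfSpecialFibreTower X T d S h36 Sigma SigmaHat hsub hne hprime hp TpH HatH hle cuspMeetsH P.admKer_normal_pi).Q j).ι →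
        MulAut.conj γ • Λ.map (((qTowerOfSpecialFibreTower X T d S h36 Sigma SigmaHat hsub hne hprime hp TpH HatH hle cuspMeetsH P.admKer_normal_pi).qhat j).comp X.toHat.toMonoidHom) ≤
            MulAut.conj h • ((Dd j).vertGp w).map ((qTowerOfSpecialFibreTower X T d S h36 Sigma SigmaHat hsub hne hprime hp TpH HatH hle cuspMeetsH P.admKer_normal_pi).Q j).ι →
          (v = w ∧ g⁻¹ * h ∈ ((Dd j).vertGp v).map ((qTowerOfSpecialFibreTower X T d S h36 Sigma SigmaHat hsub hne hprime hp TpH HatH hle cuspMeetsH P.admKer_normal_pi).Q j).ι) ∨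
          (∃ (e : E j) (k : ((qTowerOfSpecialFibreTower X T d S h36 Sigma SigmaHat hsub hne hprime hp TpH HatH hle cuspMeetsH P.admKer_normal_pi).Q j).Hat),
            ∃ p ∈ ((Dd j).vertGp (src j e)).map ((qTowerOfSpecialFibreTower X T d S h36 Sigma SigmaHat hsub hne hprime hp TpH HatH hle cuspMeetsH P.admKer_normal_pi).Q j).ι,
            ∃ q ∈ ((Dd j).vertGp (tgt j e)).map ((qTowerOfSpecialFibreTower X T d S h36 Sigma SigmaHat hsub hne hprime hp TpH HatH hle cuspMeetsH P.admKer_normal_pi).Q j).ι,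
            (src j e = v ∧ tgt j e = w ∧
                g = k * ((qTowerOfSpecialFibreTower X T d S h36 Sigma SigmaHat hsub hne hprime hp TpH HatH hle cuspMeetsH P.admKer_normal_pi).Q j).ι (c₁ j e) * p ∧
                h = k * ((qTowerOfSpecialFibreTower X T d S h36 Sigma SigmaHat hsub hne hprime hp TpH HatH hle cuspMeetsH P.admKer_normal_pi).Q j).ι (c₂ j e) * q) ∨
            (src j e = w ∧ tgt j e = v ∧
                h = k * ((qTowerOfSpecialFibreTower X T d S h36 Sigma SigmaHat hsub hne hprime hp TpH HatH hle cuspMeetsH P.admKer_normal_pi).Q j).ι (c₁ j e) * p ∧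
                g = k * ((qTowerOfSpecialFibreTower X T d S h36 Sigma SigmaHat hsub hne hprime hp TpH HatH hle cuspMeetsH P.admKer_normal_pi).Q j).ι (c₂ j e) * q)) ∨
          (∃ (u : V j) (f : ((qTowerOfSpecialFibreTower X T d S h36 Sigma SigmaHat hsub hne hprime hp TpH HatH hle cuspMeetsH P.admKer_normal_pi).Q j).Hat),
            (∃ (e : E j) (k : ((qTowerOfSpecialFibreTower X T d S h36 Sigma SigmaHat hsub hne hprime hp TpH HatH hle cuspMeetsH P.admKer_normal_pi).Q j).Hat),
              ∃ p ∈ ((Dd j).vertGp (src j e)).map ((qTowerOfSpecialFibreTower X T d S h36 Sigma SigmaHat hsub hne hprime hp TpH HatH hle cuspMeetsH P.admKer_normal_pi).Q j).ι,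
              ∃ q ∈ ((Dd j).vertGp (tgt j e)).map ((qTowerOfSpecialFibreTower X T d S h36 Sigma SigmaHat hsub hne hprime hp TpH HatH hle cuspMeetsH P.admKer_normal_pi).Q j).ι,
              (src j e = v ∧ tgt j e = u ∧
                  g = k * ((qTowerOfSpecialFibreTower X T d S h36 Sigma SigmaHat hsub hne hprime hp TpH HatH hle cuspMeetsH P.admKer_normal_pi).Q j).ι (c₁ j e) * p ∧
                  f = k * ((qTowerOfSpecialFibreTower X T d S h36 Sigma SigmaHat hsub hne hprime hp TpH HatH hle cuspMeetsH P.admKer_normal_pi).Q j).ι (c₂ j e) * q) ∨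
              (src j e = u ∧ tgt j e = v ∧
                  f = k * ((qTowerOfSpecialFibreTower X T d S h36 Sigma SigmaHat hsub hne hprime hp TpH HatH hle cuspMeetsH P.admKer_normal_pi).Q j).ι (c₁ j e) * p ∧
                  g = k * ((qTowerOfSpecialFibreTower X T d S h36 Sigma SigmaHat hsub hne hprime hp TpH HatH hle cuspMeetsH P.admKer_normal_pi).Q j).ι (c₂ j e) * q)) ∧
            (∃ (e : E j) (k : ((qTowerOfSpecialFibreTower X T d S h36 Sigma SigmaHat hsub hne hprime hp TpH HatH hle cuspMeetsH P.admKer_normal_pi).Q j).Hat),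
              ∃ p ∈ ((Dd j).vertGp (src j e)).map ((qTowerOfSpecialFibreTower X T d S h36 Sigma SigmaHat hsub hne hprime hp TpH HatH hle cuspMeetsH P.admKer_normal_pi).Q j).ι,
              ∃ q ∈ ((Dd j).vertGp (tgt j e)).map ((qTowerOfSpecialFibreTower X T d S h36 Sigma SigmaHat hsub hne hprime hp TpH HatH hle cuspMeetsH P.admKer_normal_pi).Q j).ι,
              (src j e = u ∧ tgt j e = w ∧
                  f = k * ((qTowerOfSpecialFibreTower X T d S h36 Sigma SigmaHat hsub hne hprime hp TpH HatH hle cuspMeetsH P.admKer_normal_pi).Q j).ι (c₁ j e) * p ∧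
                  h = k * ((qTowerOfSpecialFibreTower X T d S h36 Sigma SigmaHat hsub hne hprime hp TpH HatH hle cuspMeetsH P.admKer_normal_pi).Q j).ι (c₂ j e) * q) ∨
              (src j e = w ∧ tgt j e = u ∧
                  h = k * ((qTowerOfSpecialFibreTower X T d S h36 Sigma SigmaHat hsub hne hprime hp TpH HatH hle cuspMeetsH P.admKer_normal_pi).Q j).ι (c₁ j e) * p ∧
                  f = k * ((qTowerOfSpecialFibreTower X T d S h36 Sigma SigmaHat hsub hne hprime hp TpH HatH hle cuspMeetsH P.admKer_normal_pi).Q j).ι (c₂ j e) * q)))) :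
    (ofSpecialFibre X d S h36 Sigma SigmaHat hsub hne hprime hp TpH HatH hle cuspMeetsH).Prop24ii := by
  -- notation-free handle on the genuine quotient tower
  let QT := qTowerOfSpecialFibreTower X T d S h36 Sigma SigmaHat hsub hne hprime hp TpH HatH hle cuspMeetsH
    P.admKer_normal_pi
  -- the canonical profinite augmentation `Π_{X_K} ⧸ closure ι(admKer_j) → G_K` of each level quotient
  let aHat : ∀ j, (QT.Q j).Hat →* X.GK := fun j => by
    haveI : (admKerHat X T j).Normal := admKerHat_normal X T j (P.admKer_normal_pi j)
    exact QuotientGroup.lift (admKerHat X T j) (augHatGK X) (admKerHat_le_ker_augHatGK X T d j)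
  have haHat : ∀ j (z : X.PiHat), aHat j (QT.qhat j z) = augHatGK X z := by
    intro j z
    haveI : (admKerHat X T j).Normal := admKerHat_normal X T j (P.admKer_normal_pi j)
    exact QuotientGroup.lift_mk' (admKerHat X T j) (admKerHat_le_ker_augHatGK X T d j) z
  -- the canonical tempered augmentation `Π^temp_{X_K} ⧸ admKer_j → G_K`, as `aHat ∘ ι`
  let aTp : ∀ j, (QT.Q j).Tp →* X.GK := fun j => (aHat j).comp (QT.Q j).ι
  have haTp : ∀ j, (aTp j).comp (QT.qtp j) = X.augGK.toMonoidHom := by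
    intro j
    refine MonoidHom.ext fun t => ?_
    change aHat j ((QT.Q j).ι (QT.qtp j t)) = X.augGK t
    rw [QT.hq j t]
    change aHat j (QT.qhat j (X.toHat t)) = X.augGK t
    rw [haHat]
    exact DFunLike.congr_fun (augHatGK_comp_toHat X) t
  refine prop24ii_ofPiData_of_arithStatementI X T d S h36 Sigma SigmaHat hsub hne hprime hp TpH HatH hle cuspMeetsH
    P hadm Dd aTp (fun j => hI j (aTp j) (haTp j)) ?_ src tgt c₁ c₂ hA3
  -- the pull-back law: compactness is `hA0`; ampleness is PROVED
  intro j Λ hΛc hΛne hΛo γ hγ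
  refine ⟨hA0 j Λ hΛc hΛne hΛo γ hγ, ?_⟩
  -- `IsArithAmple (aTp j) K`: the image of `K` in `G_K` is `aHat(γ) · augGK(Λ) · aHat(γ)⁻¹`, open
  change IsOpen ((((MulAut.conj γ • Λ.map ((QT.qhat j).comp X.toHat.toMonoidHom)).comap (QT.Q j).ι).map (aTp j) :
    Subgroup X.GK) : Set X.GK)
  have hmap : ((MulAut.conj γ • Λ.map ((QT.qhat j).comp X.toHat.toMonoidHom)).comap (QT.Q j).ι).map (aTp j) =
      MulAut.conj (aHat j γ) • Λ.map X.augGK.toMonoidHom := by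
    change (((MulAut.conj γ • Λ.map ((QT.qhat j).comp X.toHat.toMonoidHom)).comap (QT.Q j).ι).map
      ((aHat j).comp (QT.Q j).ι)) = _
    rw [← Subgroup.map_map, Subgroup.map_comap_eq_self hγ, map_conj_smul, Subgroup.map_map]
    congr 1
    have hcomp : (aHat j).comp ((QT.qhat j).comp X.toHat.toMonoidHom) = X.augGK.toMonoidHom := by
      refine MonoidHom.ext fun t => ?_
      change aHat j (QT.qhat j (X.toHat t)) = X.augGK t
      rw [haHat]
      exact DFunLike.congr_fun (augHatGK_comp_toHat X) t
    rw [hcomp]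
  rw [hmap]
  exact isOpen_conj_smul _ hΛo

end OfSpecialFibre

end StableCurveTemperedData

end Literature.IUT.HodgeTheaters

end
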